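import Summits.QuantumAdvantage.QuantumAdvantage.Theorems.CubicForrelationNearExactIsExactCubicForm
import Summits.QuantumAdvantage.QuantumAdvantage.Theorems.CubicForrelationSignedCubicForrelationNotPrBPPStubKernelNormalFormDegree
import Mathlib.Logic.Equiv.Fin.Basic

/-!
# Crux `CubicForrelation.NearExactIsExact` (stmt-QuantumAdvantage-14043) — the CELLS of an adapted R2 frame

Certificate seat `b2b-cforr-cert` (gen 40).  HONEST FRAMING: kernel-checked bookkeeping (standard axioms) for the "(L4) R2 frame" of the
Lean roadmap for `E1280-even` (HOME/b2b-cforr-cert-g39/E1280-HANDPROOFS.md §3; HOME/b2b-cforr-cert-g37/R2-PARTNER.md §2).  Nothing about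
`θ₁₂` is claimed; NOT summit progress.

SETTING.  `κ : 𝔽₂^{3+m} → 𝔽₂` in coordinates `(y₀, y₁, y₂, s)`, `s ∈ 𝔽₂ᵐ` (vectors written `Fin.append ![y₀,y₁,y₂] s`).  The frame is
ADAPTED to a rank-2 derivative when `D_{e₀}κ(y) = (y₁ ⊕ c₁)(y₂ ⊕ c₂)` for all `y` (hypothesis `hD`; this is what …CubicFormTransport
produces from `tow_R2_frame`).  The four CELLS are `C_{ij} = {y₁ = i, y₂ = j}`; on the three cells with `(i ⊕ c₁)(j ⊕ c₂) = 0` the function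
is `e₀`-periodic and descends to the `m`-variable function `ρ_{ij}(s) = κ(0, i, j, s)`.
* `tcc_card_cells` (any `κ`): `#κ = Σ_{v ∈ 𝔽₂³} #{s : κ(v, s)}`.
* `tcc_weight` (under `hD`): `#κ = 2ᵐ + 2·(w_{c₁c₂} + w_{c₁ c̄₂} + w_{c̄₁ c₂})`, `w_{ij} = #ρ_{ij}` — the special cell carries exactly `2ᵐ` ones,
  the other three twice the weight of their descended function.
* `tcc_rho_isDegLeFun`: each `ρ_v(s) = κ(v, s)` has degree `≤ 3` if `κ` has.
* `tcc_third_rho`: the third differences of `ρ_v` are those of `κ` on the embedded vectors (so for cubic `κ` all cells have the SAME cubic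
  form `t̄ = d|_S`, `tcc_third_rho_unit`).
* `tcc_second_rho`: the second differences (quadratic ANF coefficients) of `ρ_{(y₀,i,j)}` at `0` are those of `ρ_{(0,0,0)}` plus
  `y₀·d(e₀,·,·) + i·d(e₁,·,·) + j·d(e₂,·,·)` — the cells' alternating parts differ by the GLUING FORMS `G = ι_{e₁}d`, `Γ = ι_{e₂}d`
  (and `ι_{e₀}d|_S = 0` in an adapted frame, `tcc_slice0_S`).

References: T. Kasami, N. Tokura (1970); HOME/b2b-cforr-cert-g37/R2-PARTNER.md §2 (this seat lineage).  Axioms: the standard three.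
-/

set_option linter.dupNamespace false -- D-0017: single-problem summit ⇒ `QuantumAdvantage.QuantumAdvantage` by design

namespace Summit.QuantumAdvantage.QuantumAdvantage.Theorems.CubicForrelation.NearExactIsExact

open Finset
open Literature.Computability.QuantumComplexity
open Literature.Computability.QuantumComplexity.BuzetChailloux (bxor zeroVec bxor_comm bxor_self bxor_zeroVec zeroVec_bxor
  bxor_bxor_cancel_left)
open Summit.QuantumAdvantage.QuantumAdvantage.Theorems.SignedCubicForrelationNotPrBPP (knf_isDegLeFun_comp)

variable {m : ℕ}

/-! ### Vectors in the coordinates `(y₀,y₁,y₂,s)` -/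

/-- Xor of appended vectors is appended xor. [folklore] -/
theorem tcc_append_bxor (v v' : Fin 3 → Bool) (s s' : Fin m → Bool) :
    bxor (Fin.append v s) (Fin.append v' s') = Fin.append (bxor v v') (bxor s s') := by
  funext l
  refine Fin.addCases (fun i => ?_) (fun σ => ?_) l
  · simp only [bxor, Fin.append_left]
  · simp only [bxor, Fin.append_right]

/-- The unit vector at a `y`-coordinate. [folklore] -/
theorem tcc_unit_left (t : Fin 3) :
    (fun l : Fin (3 + m) => decide (l = Fin.castAdd m t)) = Fin.append (fun l : Fin 3 => decide (l = t)) (zeroVec : Fin m → Bool) := by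
  funext l
  refine Fin.addCases (fun i => ?_) (fun σ => ?_) l
  · simp only [Fin.append_left]
    by_cases h : i = t
    · subst h; simp
    · have : Fin.castAdd m i ≠ Fin.castAdd m t := fun e => h (Fin.castAdd_inj.mp e)
      simp [h, this]
  · simp only [Fin.append_right, zeroVec]
    have : Fin.natAdd 3 σ ≠ Fin.castAdd m t := by
      intro e
      have := congrArg Fin.val e
      simp only [Fin.val_natAdd, Fin.val_castAdd] at this
      omega
    simp [this]

/-- The unit vector at an `s`-coordinate. [folklore] -/
theorem tcc_unit_right (σ : Fin m) :
    (fun l : Fin (3 + m) => decide (l = Fin.natAdd 3 σ)) = Fin.append (zeroVec : Fin 3 → Bool) (fun l : Fin m => decide (l = σ)) := by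
  funext l
  refine Fin.addCases (fun i => ?_) (fun τ => ?_) l
  · simp only [Fin.append_left, zeroVec]
    have : Fin.castAdd m i ≠ Fin.natAdd 3 σ := by
      intro e
      have := congrArg Fin.val e
      simp only [Fin.val_natAdd, Fin.val_castAdd] at this
      omega
    simp [this]
  · simp only [Fin.append_right]
    by_cases h : τ = σ
    · subst h; simp
    · have : Fin.natAdd 3 τ ≠ Fin.natAdd 3 σ := fun e => h (Fin.natAdd_inj 3 |>.mp e)
      simp [h, this]

/-- `Fin.append 0 0 = 0`. [folklore] -/
theorem tcc_append_zero : Fin.append (zeroVec : Fin 3 → Bool) (zeroVec : Fin m → Bool) = (zeroVec : Fin (3 + m) → Bool) := by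
  funext l
  refine Fin.addCases (fun i => ?_) (fun σ => ?_) l
  · simp only [Fin.append_left, zeroVec]
  · simp only [Fin.append_right, zeroVec]

/-- Coordinates of an appended vector. [folklore] -/
theorem tcc_append_castAdd (v : Fin 3 → Bool) (s : Fin m → Bool) (t : Fin 3) : Fin.append v s (Fin.castAdd m t) = v t :=
  Fin.append_left v s t

/-! ### Counting over the cells -/

/-- **Counting by cells** (any `κ`): `#{y : κ y} = Σ_{v ∈ 𝔽₂³} #{s : κ(v, s)}`. [folklore] -/
theorem tcc_card_cells (κ : (Fin (3 + m) → Bool) → Bool) :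
    #(univ.filter fun y : Fin (3 + m) → Bool => κ y = true) =
      ∑ v : Fin 3 → Bool, #(univ.filter fun s : Fin m → Bool => κ (Fin.append v s) = true) := by
  classical
  rw [card_filter]
  rw [← Fintype.sum_equiv (Fin.appendEquiv 3 m) (fun vs => if κ (Fin.append vs.1 vs.2) = true then 1 else 0)
    (fun y => if κ y = true then 1 else 0) (fun vs => rfl)]
  rw [Fintype.sum_prod_type]
  exact sum_congr rfl fun v _ => (card_filter _ _).symm

section Adapted

variable (κ : (Fin (3 + m) → Bool) → Bool) (c₁ c₂ : Bool)
  (hD : ∀ y, (κ y ^^ κ (bxor y (fun l => decide (l = Fin.castAdd m (0 : Fin 3))))) =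
    ((y (Fin.castAdd m (1 : Fin 3)) ^^ c₁) && (y (Fin.castAdd m (2 : Fin 3)) ^^ c₂)))
include hD

/-- In an adapted frame, the `y₀ = 1` half of a cell is read off the `y₀ = 0` half:
`κ(1,i,j,s) = κ(0,i,j,s) ⊕ (i ⊕ c₁)(j ⊕ c₂)`. [this work] -/
theorem tcc_top_half (i j : Bool) (s : Fin m → Bool) :
    κ (Fin.append ![true, i, j] s) = (κ (Fin.append ![false, i, j] s) ^^ ((i ^^ c₁) && (j ^^ c₂))) := by
  have h := hD (Fin.append ![false, i, j] s)
  rw [tcc_unit_left, tcc_append_bxor, bxor_zeroVec, tcc_append_castAdd, tcc_append_castAdd] at h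
  have hv : bxor ![false, i, j] (fun l : Fin 3 => decide (l = 0)) = ![true, i, j] := by
    funext l; fin_cases l <;> simp [bxor]
  rw [hv] at h
  have hi : (![false, i, j] : Fin 3 → Bool) 1 = i := rfl
  have hj : (![false, i, j] : Fin 3 → Bool) 2 = j := rfl
  rw [hi, hj] at h
  have key : ∀ A B C : Bool, (A ^^ B) = C → B = (A ^^ C) := by decide
  exact key _ _ _ h

/-- A periodic cell: if `(i ⊕ c₁)(j ⊕ c₂) = 0` the two halves of `C_{ij}` carry equally many ones. [this work] -/
theorem tcc_card_top_periodic (i j : Bool) (hij : ((i ^^ c₁) && (j ^^ c₂)) = false) :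
    #(univ.filter fun s : Fin m → Bool => κ (Fin.append ![true, i, j] s) = true) =
      #(univ.filter fun s : Fin m → Bool => κ (Fin.append ![false, i, j] s) = true) := by
  refine congrArg card (filter_congr fun s _ => ?_)
  rw [tcc_top_half κ c₁ c₂ hD, hij, Bool.xor_false]

/-- The special cell: if `(i ⊕ c₁)(j ⊕ c₂) = 1` the two halves of `C_{ij}` carry `2ᵐ` ones together. [this work] -/
theorem tcc_card_top_special (i j : Bool) (hij : ((i ^^ c₁) && (j ^^ c₂)) = true) :
    #(univ.filter fun s : Fin m → Bool => κ (Fin.append ![true, i, j] s) = true) +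
      #(univ.filter fun s : Fin m → Bool => κ (Fin.append ![false, i, j] s) = true) = 2 ^ m := by
  have hc : (univ.filter fun s : Fin m → Bool => κ (Fin.append ![true, i, j] s) = true) =
      univ.filter fun s : Fin m → Bool => ¬ (κ (Fin.append ![false, i, j] s) = true) := by
    refine filter_congr fun s _ => ?_
    rw [tcc_top_half κ c₁ c₂ hD, hij, Bool.xor_true]
    cases κ (Fin.append ![false, i, j] s) <;> simp
  rw [hc, filter_not, card_sdiff_of_subset (filter_subset _ _), card_univ, Fintype.card_fun, Fintype.card_bool, Fintype.card_fin]
  have hle : #(univ.filter fun s : Fin m → Bool => κ (Fin.append ![false, i, j] s) = true) ≤ 2 ^ m := by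
    calc _ ≤ #(univ : Finset (Fin m → Bool)) := card_le_card (filter_subset _ _)
      _ = 2 ^ m := by rw [card_univ, Fintype.card_fun, Fintype.card_bool, Fintype.card_fin]
  omega

/-- **The weight in an adapted R2 frame.**  `#κ = 2ᵐ + 2·(w(c₁,c₂) + w(c₁,c̄₂) + w(c̄₁,c₂))` with `w(i,j) = #{s : κ(0,i,j,s)}`: the cell
`(c̄₁, c̄₂)` (where `D_{e₀}κ = 1`) carries exactly `2ᵐ` ones and each of the other three cells twice the weight of its descended function.
(For `m = 9`: `e = 512 + 2(w₀₀ + w₀₁ + w₁₀)`, R2-PARTNER.md §2.) [this work] -/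
theorem tcc_weight :
    #(univ.filter fun y : Fin (3 + m) → Bool => κ y = true) =
      2 ^ m + 2 * (#(univ.filter fun s : Fin m → Bool => κ (Fin.append ![false, c₁, c₂] s) = true) +
        #(univ.filter fun s : Fin m → Bool => κ (Fin.append ![false, c₁, !c₂] s) = true) +
        #(univ.filter fun s : Fin m → Bool => κ (Fin.append ![false, !c₁, c₂] s) = true)) := by
  rw [tcc_card_cells]
  -- the eight cells' halves
  have hsum : ∀ F : (Fin 3 → Bool) → ℕ, ∑ v : Fin 3 → Bool, F v =
      F ![true, true, true] + F ![true, true, false] + F ![true, false, true] + F ![true, false, false] +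
        F ![false, true, true] + F ![false, true, false] + F ![false, false, true] + F ![false, false, false] := by
    intro F
    let e : (Fin 3 → Bool) ≃ Bool × Bool × Bool :=
      ⟨fun c => (c 0, c 1, c 2), fun t => ![t.1, t.2.1, t.2.2], fun c => by funext i; fin_cases i <;> rfl, fun t => rfl⟩
    rw [Fintype.sum_equiv e F (fun t => F ![t.1, t.2.1, t.2.2]) (fun c => by
      show F c = F ![c 0, c 1, c 2]; congr 1; funext i; fin_cases i <;> rfl)]
    rw [Fintype.sum_prod_type, Fintype.sum_bool, Fintype.sum_prod_type, Fintype.sum_prod_type, Fintype.sum_bool, Fintype.sum_bool,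
      Fintype.sum_bool, Fintype.sum_bool, Fintype.sum_bool, Fintype.sum_bool]
    ring
  rw [hsum]
  have P := fun i j h => tcc_card_top_periodic κ c₁ c₂ hD i j h
  have S := fun i j h => tcc_card_top_special κ c₁ c₂ hD i j h
  cases c₁ <;> cases c₂
  · have h1 := S true true rfl; have h2 := P true false rfl; have h3 := P false true rfl; have h4 := P false false rfl
    simp only [Bool.not_false] at *
    omega
  · have h1 := P true true rfl; have h2 := S true false rfl; have h3 := P false true rfl; have h4 := P false false rfl
    simp only [Bool.not_false, Bool.not_true] at *
    omega
  · have h1 := P true true rfl; have h2 := P true false rfl; have h3 := S false true rfl; have h4 := P false false rfl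
    simp only [Bool.not_false, Bool.not_true] at *
    omega
  · have h1 := P true true rfl; have h2 := P true false rfl; have h3 := P false true rfl; have h4 := S false false rfl
    simp only [Bool.not_true] at *
    omega

/-- In an adapted frame the slice of the cubic form along `e₀` vanishes on `S × S`: `d(e₀, e_σ, e_τ) = 0` for `s`-coordinates `σ, τ`
(the derivative along `e₀` only involves `y₁, y₂`). [this work] -/
theorem tcc_slice0_S (σ τ : Fin m) (x : Fin (3 + m) → Bool) :
    (((κ x ^^ κ (bxor x (fun l => decide (l = Fin.castAdd m (0 : Fin 3))))) ^^
        (κ (bxor x (fun l => decide (l = Fin.natAdd 3 τ))) ^^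
          κ (bxor (bxor x (fun l => decide (l = Fin.natAdd 3 τ))) (fun l => decide (l = Fin.castAdd m (0 : Fin 3)))))) ^^
      ((κ (bxor x (fun l => decide (l = Fin.natAdd 3 σ))) ^^
          κ (bxor (bxor x (fun l => decide (l = Fin.natAdd 3 σ))) (fun l => decide (l = Fin.castAdd m (0 : Fin 3))))) ^^
        (κ (bxor (bxor x (fun l => decide (l = Fin.natAdd 3 σ))) (fun l => decide (l = Fin.natAdd 3 τ))) ^^
          κ (bxor (bxor (bxor x (fun l => decide (l = Fin.natAdd 3 σ))) (fun l => decide (l = Fin.natAdd 3 τ)))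
            (fun l => decide (l = Fin.castAdd m (0 : Fin 3))))))) = false := by
  rw [hD, hD, hD, hD]
  have n1 : ∀ ρ : Fin m, (fun l : Fin (3 + m) => decide (l = Fin.natAdd 3 ρ)) (Fin.castAdd m (1 : Fin 3)) = false := by
    intro ρ
    have : Fin.castAdd m (1 : Fin 3) ≠ Fin.natAdd 3 ρ := by
      intro e; have := congrArg Fin.val e; simp only [Fin.val_natAdd, Fin.val_castAdd] at this; omega
    simp [this]
  have n2 : ∀ ρ : Fin m, (fun l : Fin (3 + m) => decide (l = Fin.natAdd 3 ρ)) (Fin.castAdd m (2 : Fin 3)) = false := by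
    intro ρ
    have : Fin.castAdd m (2 : Fin 3) ≠ Fin.natAdd 3 ρ := by
      intro e; have := congrArg Fin.val e; simp only [Fin.val_natAdd, Fin.val_castAdd] at this; omega
    simp [this]
  simp only [bxor, n1, n2, Bool.xor_false]
  have key : ∀ A : Bool, ((A ^^ A) ^^ (A ^^ A)) = false := by decide
  exact key _

end Adapted

/-! ### The descended functions `ρ_v(s) = κ(v, s)` -/

section Rho

variable (κ : (Fin (3 + m) → Bool) → Bool) (v : Fin 3 → Bool)

/-- The coordinates of `s ↦ (v, s)` are affine. [folklore] -/
theorem tcc_append_coord_deg (l : Fin (3 + m)) : IsDegLeFun 1 (fun s : Fin m → Bool => Fin.append v s l) := by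
  refine Fin.addCases (fun i => ?_) (fun σ => ?_) l
  · have : (fun s : Fin m → Bool => Fin.append v s (Fin.castAdd m i)) = fun _ => v i := by
      funext s; exact Fin.append_left v s i
    rw [this]; exact isDegLeFun_const 1 (v i)
  · have : (fun s : Fin m → Bool => Fin.append v s (Fin.natAdd 3 σ)) = fun s => s σ := by
      funext s; exact Fin.append_right v s σ
    rw [this]; exact isDegLeFun_apply σ le_rfl

/-- **The descended functions are cubic**: `ρ_v = κ(v, ·)` has degree `≤ d` if `κ` has. [folklore] -/
theorem tcc_rho_isDegLeFun {d : ℕ} (hκ : IsDegLeFun d κ) : IsDegLeFun d (fun s : Fin m → Bool => κ (Fin.append v s)) :=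
  knf_isDegLeFun_comp hκ _ fun l => tcc_append_coord_deg v l

/-- **Third differences of a descended function** are those of `κ` on the embedded vectors (any `κ`, any base point). [folklore] -/
theorem tcc_third_rho (u₁ u₂ u₃ x : Fin m → Bool) :
    let ρ : (Fin m → Bool) → Bool := fun s => κ (Fin.append v s)
    let ι : (Fin m → Bool) → (Fin (3 + m) → Bool) := fun u => Fin.append (zeroVec : Fin 3 → Bool) u
    (((ρ x ^^ ρ (bxor x u₃)) ^^ (ρ (bxor x u₂) ^^ ρ (bxor (bxor x u₂) u₃))) ^^
        ((ρ (bxor x u₁) ^^ ρ (bxor (bxor x u₁) u₃)) ^^ (ρ (bxor (bxor x u₁) u₂) ^^ ρ (bxor (bxor (bxor x u₁) u₂) u₃)))) =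
      (((κ (Fin.append v x) ^^ κ (bxor (Fin.append v x) (ι u₃))) ^^
          (κ (bxor (Fin.append v x) (ι u₂)) ^^ κ (bxor (bxor (Fin.append v x) (ι u₂)) (ι u₃)))) ^^
        ((κ (bxor (Fin.append v x) (ι u₁)) ^^ κ (bxor (bxor (Fin.append v x) (ι u₁)) (ι u₃))) ^^
          (κ (bxor (bxor (Fin.append v x) (ι u₁)) (ι u₂)) ^^ κ (bxor (bxor (bxor (Fin.append v x) (ι u₁)) (ι u₂)) (ι u₃))))) := by
  intro ρ ι
  simp only [ρ, ι, tcc_append_bxor, bxor_zeroVec]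

/-- **All cells share the cubic form.**  For `deg κ ≤ 3`, the value of the third difference of `ρ_v` on unit vectors `e_σ, e_τ, e_υ` of
`𝔽₂ᵐ` is the value of the third difference of `κ` on `e_{3+σ}, e_{3+τ}, e_{3+υ}` — independently of the cell `v` and of the base points.
[this work] -/
theorem tcc_third_rho_unit (hκ : IsDegLeFun 3 κ) (σ τ υ : Fin m) (x : Fin m → Bool) (x' : Fin (3 + m) → Bool) :
    let ρ : (Fin m → Bool) → Bool := fun s => κ (Fin.append v s)
    (((ρ x ^^ ρ (bxor x (fun l => decide (l = υ)))) ^^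
          (ρ (bxor x (fun l => decide (l = τ))) ^^ ρ (bxor (bxor x (fun l => decide (l = τ))) (fun l => decide (l = υ))))) ^^
        ((ρ (bxor x (fun l => decide (l = σ))) ^^ ρ (bxor (bxor x (fun l => decide (l = σ))) (fun l => decide (l = υ)))) ^^
          (ρ (bxor (bxor x (fun l => decide (l = σ))) (fun l => decide (l = τ))) ^^
            ρ (bxor (bxor (bxor x (fun l => decide (l = σ))) (fun l => decide (l = τ))) (fun l => decide (l = υ)))))) =
      (((κ x' ^^ κ (bxor x' (fun l => decide (l = Fin.natAdd 3 υ)))) ^^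
          (κ (bxor x' (fun l => decide (l = Fin.natAdd 3 τ))) ^^
            κ (bxor (bxor x' (fun l => decide (l = Fin.natAdd 3 τ))) (fun l => decide (l = Fin.natAdd 3 υ))))) ^^
        ((κ (bxor x' (fun l => decide (l = Fin.natAdd 3 σ))) ^^
            κ (bxor (bxor x' (fun l => decide (l = Fin.natAdd 3 σ))) (fun l => decide (l = Fin.natAdd 3 υ)))) ^^
          (κ (bxor (bxor x' (fun l => decide (l = Fin.natAdd 3 σ))) (fun l => decide (l = Fin.natAdd 3 τ))) ^^
            κ (bxor (bxor (bxor x' (fun l => decide (l = Fin.natAdd 3 σ))) (fun l => decide (l = Fin.natAdd 3 τ)))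
              (fun l => decide (l = Fin.natAdd 3 υ)))))) := by
  intro ρ
  have h := tcc_third_rho κ v (fun l => decide (l = σ)) (fun l => decide (l = τ)) (fun l => decide (l = υ)) x
  dsimp only at h
  dsimp only [ρ]
  rw [h, ← tcc_unit_right σ, ← tcc_unit_right τ, ← tcc_unit_right υ]
  exact tcf_third_const κ hκ _ _ _ _ _

/-- **Second differences of the descended functions.**  For `deg κ ≤ 3` and `s`-coordinates `σ, τ`: the second difference of
`ρ_{(y₀,y₁,y₂)}` at `0` along `e_σ, e_τ` (its quadratic ANF coefficient when `σ ≠ τ`) equals that of `ρ_{(0,0,0)}` plus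
`y₀·d(e₀,e_{3+σ},e_{3+τ}) ⊕ y₁·d(e₁,…) ⊕ y₂·d(e₂,…)`: the cells' alternating parts differ by the gluing forms `ι_{e_t} d`. [this work] -/
theorem tcc_second_rho (hκ : IsDegLeFun 3 κ) (σ τ : Fin m) :
    let S : (Fin (3 + m) → Bool) → Bool := fun x =>
      (κ x ^^ κ (bxor x (fun l => decide (l = Fin.natAdd 3 τ)))) ^^
        (κ (bxor x (fun l => decide (l = Fin.natAdd 3 σ))) ^^
          κ (bxor (bxor x (fun l => decide (l = Fin.natAdd 3 σ))) (fun l => decide (l = Fin.natAdd 3 τ))))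
    S (Fin.append v zeroVec) =
      (((S zeroVec ^^ (v 0 && (S zeroVec ^^ S (bxor zeroVec (fun l => decide (l = Fin.castAdd m (0 : Fin 3))))))) ^^
          (v 1 && (S zeroVec ^^ S (bxor zeroVec (fun l => decide (l = Fin.castAdd m (1 : Fin 3))))))) ^^
        (v 2 && (S zeroVec ^^ S (bxor zeroVec (fun l => decide (l = Fin.castAdd m (2 : Fin 3))))))) := by
  intro S
  -- `S (x ⊕ b•u) = S x ⊕ b•(S x' ⊕ S (x' ⊕ u))` for cubic `κ` (base-point independence of the third difference)
  have step : ∀ (b : Bool) (u x : Fin (3 + m) → Bool),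
      S (bxor x (fun l => b && u l)) = (S x ^^ (b && (S zeroVec ^^ S (bxor zeroVec u)))) := by
    intro b u x
    have h1 := tcf_third_smul1 κ b u (fun l => decide (l = Fin.natAdd 3 σ)) (fun l => decide (l = Fin.natAdd 3 τ)) x
    have h2 := tcf_third_const κ hκ u (fun l => decide (l = Fin.natAdd 3 σ)) (fun l => decide (l = Fin.natAdd 3 τ)) x zeroVec
    dsimp only [S]
    have key : ∀ A B C : Bool, (A ^^ B) = C → B = (A ^^ C) := by decide
    refine key _ _ _ ?_
    rw [h1, h2]
  have hv : Fin.append v (zeroVec : Fin m → Bool) =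
      bxor (bxor (bxor zeroVec (fun l => v 0 && (fun l => decide (l = Fin.castAdd m (0 : Fin 3))) l))
        (fun l => v 1 && (fun l => decide (l = Fin.castAdd m (1 : Fin 3))) l))
        (fun l => v 2 && (fun l => decide (l = Fin.castAdd m (2 : Fin 3))) l) := by
    rw [tcc_unit_left, tcc_unit_left, tcc_unit_left]
    funext l
    refine Fin.addCases (fun i => ?_) (fun ρ' => ?_) l
    · simp only [bxor, Fin.append_left, zeroVec]
      fin_cases i <;> simp
    · simp only [bxor, Fin.append_right, zeroVec]
      simp
  rw [hv, step, step, step, zeroVec_bxor]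

end Rho

end Summit.QuantumAdvantage.QuantumAdvantage.Theorems.CubicForrelation.NearExactIsExact
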